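import Literature.AnabelianGeometry.AbsoluteAnabelian.AbsAnabStarConditionSplitCompletion
import Literature.AnabelianGeometry.AbsoluteAnabelian.AbsTopIThm26SplitModelInstances
import Literature.AnabelianGeometry.SemiGraphs.ProSigmaCompletionInjective
import Summits.ABC.IUTFork.MLFGaloisTFG
import HarnessLib

/-!
# [AbsAnab] Lemma 1.1.4 (ii): (∗) and the p. 8 step at `F̂_n × G_K ↠ G_K` — UNCONDITIONAL forms and
# the non-abelian non-vacuity witness (Summits-side assembly)

S. Mochizuki, *The Absolute Anabelian Geometry of Hyperbolic Curves* (2004) [AbsAnab], Lemma 1.1.4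
(ii) p. 7 (condition (∗), FACT-LIST F-0012 `FundamentalExtension.StarCondition`) and its proof p. 8
(`CoinvariantRankConstant`, F-0001).  abc-iut-f-090's Literature-side
`AbsAnabStarConditionSplitCompletion.lean` proves (∗) at the split model `Γ̂ × G ↠ G` for every
finitely generated `Γ` and every profinite `G`, and the p. 8 step GIVEN "`G` topologically finitely
generated".  For `G = G_K`, `K/ℚ_p` finite, that input is [NSW] Thm 7.5.10 — a THEOREM of the tree,
but Summits-side (`isTopologicallyFinitelyGenerated_absoluteGaloisGroup_padic`, abc-iut-L4-d1's
Gaschütz route); this file (abc-iut cell, block F seat abc-iut-f-090 gen 3, row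
«STAR-SPLIT-NONABELIAN») assembles the UNCONDITIONAL forms:

* `FundamentalExtension.coinvariantRankConstant_holds` — **F-0001 at `F̂_n × G_K ↠ G_K`**: for every
  open `Π″`, `δ¹_l(Π″) − δ¹_l(G″)` is independent of `l`; unconditional;
* `Summit.ABC.IUTFork.exists_mlfBase_starCondition_nonabelian` — **non-vacuity of the hypotheses of
  [AbsAnab] Lemma 1.1.4 (ii) with NON-ABELIAN `Δ`**: over every MLF base `(p, K)` there is an
  extension with `Δ` topologically finitely generated and NON-COMMUTATIVE (`Δ ≅ F̂₂`), splitting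
  over an open subgroup, satisfying (∗) and the p. 8 step (all earlier witnesses in the tree had `Δ`
  procyclic central).

HONEST LABEL: split model = trivial outer action, NOT the extension of a curve (no étale `π₁` in the
tree); a satisfiability witness.  [AbsAnab] is refereed; nothing here bears on [IUTchIII] Cor. 3.12
or takes a side; typed ≠ proved elsewhere.  Theorems only; axioms standard.
-/

noncomputable section

open Topology Field

namespace Summit.ABC.IUTFork

open Literature.AnabelianGeometry.AbsoluteAnabelian
open Literature.AnabelianGeometry.AbsoluteAnabelian.FundamentalExtension
open Literature.AnabelianGeometry.SemiGraphs.SemiGraphOfAnabelioids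
open Literature.IUT.HodgeTheaters (profiniteCompletion toCompletion)

/-- **F-0001 — [AbsAnab] Lemma 1.1.4 (ii), the p. 8 step (`CoinvariantRankConstant`), instance form
at `F̂_n × G_K ↠ G_K`, UNCONDITIONAL** (`K/ℚ_p` finite; "`G_K` topologically finitely generated" =
[NSW] 7.5.10 discharged by `isTopologicallyFinitelyGenerated_absoluteGaloisGroup_padic`): for every
open `Π″ ⊆ F̂_n × G_K` with image `G″`, `δ¹_{l₁}(Π″) − δ¹_{l₁}(G″) = δ¹_{l₂}(Π″) − δ¹_{l₂}(G″)`.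
HONEST LABEL: split model (trivial outer action). [cite: MochizukiAbsAnab2004, proof of Lemma 1.1.4 (ii) p.8] -/
theorem _root_.Literature.AnabelianGeometry.AbsoluteAnabelian.FundamentalExtension.coinvariantRankConstant_holds
    (n p : ℕ) [Fact p.Prime] (K : Type) [Field K] [CharZero K] [Algebra ℚ_[p] K]
    [FiniteDimensional ℚ_[p] K] :
    (⟨ProfiniteGrp.of (profiniteCompletion (FreeGroup (Fin n)) × absoluteGaloisGroup K),
        absoluteGaloisGrp K,
        ContinuousMonoidHom.snd (profiniteCompletion (FreeGroup (Fin n))) (absoluteGaloisGroup K),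
        Prod.snd_surjective⟩ : FundamentalExtension.{0}).CoinvariantRankConstant :=
  coinvariantRankConstant_split_profiniteCompletion_freeGroup_of_tfg n K p
    (isTopologicallyFinitelyGenerated_absoluteGaloisGroup_padic p K)

/-- In the free group on `Fin 2`, the two generators do not commute. [folklore] -/
theorem freeGroup_of_zero_mul_of_one_ne :
    FreeGroup.of (0 : Fin 2) * FreeGroup.of 1 ≠ FreeGroup.of 1 * FreeGroup.of 0 := by
  decide

/-- **Non-vacuity of the hypotheses of [AbsAnab] Lemma 1.1.4 (ii) WITH NON-ABELIAN `Δ`.**  Over every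
MLF base `(p, K)` (`K/ℚ_p` finite) there is an extension `1 → Δ → Π → G → 1` with MLF base data,
`Δ` topologically finitely generated and NON-COMMUTATIVE, which splits over an open subgroup of `G`
and satisfies condition (∗) (`StarCondition`) and the p. 8 step (`CoinvariantRankConstant`) — namely
`Π := F̂₂ × G_K` (`Δ = F̂₂ × 1`; the generators of `F₂ ↪ F̂₂` do not commute).  HONEST LABEL: trivial
outer action, not a curve's extension. [cite: MochizukiAbsAnab2004, Lemma 1.1.4 (ii) p.7] -/
theorem exists_mlfBase_starCondition_nonabelian (p : ℕ) [Fact p.Prime] (K : Type) [Field K]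
    [CharZero K] [Algebra ℚ_[p] K] [FiniteDimensional ℚ_[p] K] :
    ∃ E : FundamentalExtension.{0}, Nonempty E.MLFBase ∧
      (∃ a ∈ E.geom, ∃ b ∈ E.geom, a * b ≠ b * a) ∧ IsTopologicallyFinitelyGenerated E.geom ∧
      E.SplitsOverOpenSubgroup ∧ E.StarCondition ∧ E.CoinvariantRankConstant := by
  let Fh := profiniteCompletion (FreeGroup (Fin 2))
  let E : FundamentalExtension.{0} :=
    ⟨ProfiniteGrp.of (Fh × absoluteGaloisGroup K), absoluteGaloisGrp K,
      ContinuousMonoidHom.snd Fh (absoluteGaloisGroup K), Prod.snd_surjective⟩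
  have hmem : ∀ x : Fh × absoluteGaloisGroup K, (x : E.arith) ∈ E.geom ↔ x.2 = 1 := fun _ => Iff.rfl
  have hι : IsProSigmaCompletion {q | q.Prime} (toCompletion (FreeGroup (Fin 2))) :=
    IsProSigmaCompletion.isProSigmaCompletion_toCompletion _
  refine ⟨E, ⟨{ p := p, K := K, galIso := ContinuousMulEquiv.refl _ }⟩, ?_, ?_,
    splitsOverOpenSubgroup_holds 2 K, starCondition_holds 2 K, coinvariantRankConstant_holds 2 p K⟩
  · -- `Δ = F̂₂ × 1` is not commutative: `F₂ ↪ F̂₂` and `x₀ x₁ ≠ x₁ x₀` in `F₂`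
    refine ⟨((toCompletion _ (FreeGroup.of 0), 1) : Fh × absoluteGaloisGroup K), (hmem _).mpr rfl,
      ((toCompletion _ (FreeGroup.of 1), 1) : Fh × absoluteGaloisGroup K), (hmem _).mpr rfl, ?_⟩
    intro h
    have h1 : toCompletion (FreeGroup (Fin 2)) (FreeGroup.of 0 * FreeGroup.of 1) =
        toCompletion (FreeGroup (Fin 2)) (FreeGroup.of 1 * FreeGroup.of 0) := by
      rw [map_mul, map_mul]
      exact congrArg Prod.fst h
    exact freeGroup_of_zero_mul_of_one_ne
      (IsProSigmaCompletion.injective_of_isFreeGroup hι ⟨2, Nat.prime_two, Nat.prime_two⟩ h1)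
  · -- `Δ` is topologically finitely generated (image of `F̂₂`)
    obtain ⟨j, hj⟩ := exists_surjective_toGeom_split Fh K
    exact (IsProSigmaCompletion.isTopologicallyFinitelyGenerated_of_fg hι).of_surjective j hj

end Summit.ABC.IUTFork

end
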